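import Literature.AlgebraicGeometry.AbelianSchemes.AbelianSchemeOverMulNEtale
import Literature.AlgebraicGeometry.AbelianSchemes.AbelianSchemeDualPair
import Literature.AlgebraicGeometry.Morphisms.FiniteEtaleGeometricFibreCard
import HarnessLib

/-!
# The `m`-torsion of the kernel of a homomorphism of abelian schemes has locally constant geometric fibre count

Layer `Literature/AlgebraicGeometry/AbelianSchemes`, namespace `Literature.AlgebraicGeometry.AbelianSchemes.AbelianSchemeOver`.
Cell `hodgecm-mathlib` (D-0151), F-DAG price sheet §5b second-wave hand (h9) «local constancy of the type», FILE 2β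
(author B-p02 (g12)); count-neutral capital, PROOF lane, theorems only.  HC_CM is proved only modulo the 7 printed
citations until rung 0 closes; this file asserts nothing about HC.

## Sources

* [MumfordFogartyKirwan1994] App. 7A (pp. 234–235): the moduli space `𝒜_{g,d,n}` of polarised abelian schemes of
  degree `d²` is the disjoint union of the OPEN AND CLOSED pieces `𝒜_{g,δ,n}` indexed by the types `δ` with
  `∏ δᵢ = d` («`ker(λ) ≅ ∏ ℤ/δᵢℤ × ∏ μ_{δᵢ}`»); the present file supplies the scheme-theoretic input of that local
  constancy: the `m`-torsion of `ker λ` is a finite étale `S`-scheme, whose degree is locally constant.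
* [GortzWedhorn2020] Prop. 9.3 / Def.–Prop. 9.7 (equalisers and the diagonal), (12.6.1) (degree of a finite locally
  free morphism is locally constant), Prop. 12.21; [GortzWedhorn2023] Remark 18.30 (the diagonal of an unramified
  morphism is open) — through ★ `Morphisms/SectionEqualizerClopen` and ★ `Morphisms/FiniteEtaleGeometricFibreCard`.
* [BLRNeronModels1990] §7.3 Lemma 2 (b) (p. 180): `[m] : A → A` is (finite) étale when `m` is invertible on the base —
  ★ `AbelianSchemeOverMulNEtale`.

## What is proved (no `def`, no named fact, no instance, no notation, no `sorry`)

For abelian schemes `A`, `B` over `S`, an `S`-homomorphism `f : A.X ⟶ B.X` (`[IsMonHom f]`) and `m : ℕ` invertible in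
every residue field of `S`:

* §1 plumbing — `pow_id_comp_eq_comp_pow_id` (`[m]_A ≫ f = f ≫ [m]_B`), `unit_eq_one` (`η = 1` in `Hom_S(S, A)`),
  `unit_comp_pow_id` (`η ≫ [m] = η`), `one_fibrePoints_left` (the unit point of `A_s(Ω)` lies over `s ≫ ε`);
* §2 **`exists_finite_etale_specOver_equiv_ker_torsion_left`** — there is a FINITE ÉTALE `S`-scheme `κ : K ⟶ S`
  (namely `K_m(f) = Eq(σ, τ) ⊆ A[m]`, the equaliser of the two `S`-maps `A[m] → B[m]` induced by `f` and by the unit,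
  open and closed in the finite étale `A[m]`) whose `Ω`-points over any field-valued point `s : Spec Ω → S` are in
  bijection with the morphisms `z : Spec Ω → A` over `s` with `z ≫ f = s ≫ ε_B`, `z ≫ [m] = s ≫ ε_A`;
  `nonempty_kerTorsionLeft_equiv_fibrePoints` — these are the points `{u ∈ A_s(Ω) | f(u) = 1, u^m = 1}` of the tree's
  `A.FibrePoints s = Hom_S(Spec Ω, A)` (Mathlib's `Hom`-group); **`exists_finite_etale_specOver_equiv_ker_torsion`** —
  the same statement in that currency;
* §3 **`natCard_ker_torsion_fibrePoints_eq_of_preconnectedSpace`** — over a (pre)connected base the number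
  `#{u ∈ A_s̄(Ω) | f(u) = 1, u^m = 1}` is the same at any two geometric points `s̄`, `t̄` (possibly with different
  separably closed fields); `finite_ker_torsion_fibrePoints` (finiteness) and
  `exists_finrank_eq_natCard_ker_torsion_fibrePoints` (the count is the degree `κ.finrank b` at any `b ∈ S`).

## References
* [MumfordFogartyKirwan1994] D. Mumford, J. Fogarty, F. Kirwan, *Geometric Invariant Theory*, 3rd ed. (1994), App. 7A
  (pp. 234–235); Ch. 6 §1 (p. 115).
* [GortzWedhorn2020] U. Görtz, T. Wedhorn, *Algebraic Geometry I*, 2nd ed. (2020), Prop. 9.3, Def./Prop. 9.7, (12.6.1),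
  Prop. 12.21.
* [GortzWedhorn2023] U. Görtz, T. Wedhorn, *Algebraic Geometry II* (2023), Remark 18.30 and Prop. 18.29.
* [BLRNeronModels1990] S. Bosch, W. Lütkebohmert, M. Raynaud, *Néron Models* (1990), §7.3 Lemma 2 (b) (p. 180).
-/

noncomputable section

universe u

open CategoryTheory CategoryTheory.Limits AlgebraicGeometry MonoidalCategory CartesianMonoidalCategory

open scoped MonObj

namespace Literature.AlgebraicGeometry.AbelianSchemes

namespace AbelianSchemeOver

open Literature.AlgebraicGeometry.Morphisms Literature.AlgebraicGeometry.Motives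

variable {S : Scheme.{u}} (A : AbelianSchemeOver S) {B : AbelianSchemeOver S} (f : A.X ⟶ B.X) [IsMonHom f]

/-! ### §1 Plumbing: `[m]` commutes with homomorphisms; the unit of a group object is `m`-torsion -/

/-- A homomorphism commutes with multiplication by `m`: `[m]_A ≫ f = f ≫ [m]_B` (`[m] = (𝟙)^m` in the `Hom`-monoid;
Mathlib `MonObj.pow_comp` / `MonObj.comp_pow`). [cite: MumfordFogartyKirwan1994, Ch. 6 §1 (p. 115)] -/
theorem pow_id_comp_eq_comp_pow_id (m : ℕ) :
    ((𝟙 A.X : A.X ⟶ A.X) ^ m) ≫ f = f ≫ ((𝟙 B.X : B.X ⟶ B.X) ^ m) := by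
  rw [MonObj.pow_comp, MonObj.comp_pow, Category.id_comp, Category.comp_id]

omit [IsMonHom f] in
/-- The unit section is the unit of the `Hom`-group `Hom_S(S, A)`: `η = 1`. [cite: MumfordFogartyKirwan1994, Ch. 6 §1 (p. 115)] -/
theorem unit_eq_one : (η[A.X] : 𝟙_ (Over S) ⟶ A.X) = 1 := by
  rw [Hom.one_def, Subsingleton.elim (toUnit (𝟙_ (Over S))) (𝟙 _), Category.id_comp]

omit [IsMonHom f] in
/-- The unit section is `m`-torsion: `η ≫ [m] = η`. [cite: MumfordFogartyKirwan1994, Ch. 6 §1 (p. 115)] -/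
theorem unit_comp_pow_id (m : ℕ) : (η[A.X] : 𝟙_ (Over S) ⟶ A.X) ≫ ((𝟙 A.X : A.X ⟶ A.X) ^ m) = η[A.X] := by
  rw [MonObj.comp_pow, Category.comp_id, unit_eq_one, one_pow]

omit [IsMonHom f] in
/-- The underlying morphism of the unit point `1 ∈ A_s(Ω)` over `s : Spec Ω → S` is `s ≫ ε` (`ε = A.unitSection`, ★
`AbelianSchemeDualPair`). [cite: MumfordFogartyKirwan1994, Ch. 6 §1 (p. 115)] -/
theorem one_fibrePoints_left {Ω : Type u} [Field Ω] (s : Spec (.of Ω) ⟶ S) :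
    (1 : A.FibrePoints s).left = s ≫ A.unitSection := by
  have ht := Over.w (toUnit (Over.mk s) : Over.mk s ⟶ 𝟙_ (Over S))
  rw [Over.tensorUnit_hom] at ht
  have ht' : (toUnit (Over.mk s) : Over.mk s ⟶ 𝟙_ (Over S)).left = s :=
    (Category.comp_id (toUnit (Over.mk s) : Over.mk s ⟶ 𝟙_ (Over S)).left).symm.trans ht
  rw [Hom.one_def, Over.comp_left, ht']
  rfl

/-! ### §2 The finite étale `S`-scheme `K_m(f)` and its geometric points -/

/-- **The `m`-torsion of `ker f` is a finite étale `S`-scheme with the expected geometric points** (scheme-level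
form).  For an `S`-homomorphism `f : A → B` of abelian schemes and `m` invertible in the residue fields of `S`, there is a
finite étale `κ : K → S` whose `Ω`-points over every field-valued point `s : Spec Ω → S` correspond bijectively to the
morphisms `z : Spec Ω → A` over `s` with `z ≫ f = s ≫ ε_B` and `z ≫ [m] = s ≫ ε_A`.  Construction: `K = Eq(σ, τ) ⊆ A[m]`,
the equaliser of the two `S`-maps `σ = (π, ι ≫ f)`, `τ = (π, π ≫ ε_B)` from `A[m] = S ×_{ε,A,[m]} A` to `B[m]`, i.e. the
base change of the diagonal of `B[m] → S` along `(σ, τ)`; `B[m] → S` is finite étale (★ `isFinite_fst_unit_pow_id`,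
★ `etale_fst_unit_pow_id`), hence unramified (diagonal an OPEN immersion, Mathlib `isOpenImmersion_diagonal`) and
separated (diagonal a CLOSED immersion), so `K → A[m]` is an open and closed immersion and `K → S` is finite étale
([GortzWedhorn2020] Prop. 9.3 / Def.–Prop. 9.7; [GortzWedhorn2023] Remark 18.30; the pattern of ★
`Morphisms/SectionEqualizerClopen`). [cite: MumfordFogartyKirwan1994, App. 7A (pp. 234–235)]
[cite: GortzWedhorn2020, Def./Prop. 9.7] [cite: GortzWedhorn2023, Remark 18.30 and Prop. 18.29]
[cite: BLRNeronModels1990, §7.3 Lemma 2 (b) (p. 180)] -/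
theorem exists_finite_etale_specOver_equiv_ker_torsion_left {m : ℕ} (hm : ∀ s : S, (m : S.residueField s) ≠ 0) :
    ∃ (K : Scheme.{u}) (κ : K ⟶ S), IsFinite κ ∧ Etale κ ∧
      ∀ (Ω : Type u) [Field Ω] (s : Spec (.of Ω) ⟶ S),
        Nonempty ({x : Spec (.of Ω) ⟶ K // x ≫ κ = s} ≃
          {z : Spec (.of Ω) ⟶ A.X.left // z ≫ A.X.hom = s ∧ z ≫ f.left = s ≫ B.unitSection ∧
            z ≫ (((𝟙 A.X : A.X ⟶ A.X) ^ m : A.X ⟶ A.X)).left = s ≫ A.unitSection}) := by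
  -- the multiplications `[m]` (opaque names with their defining equations)
  obtain ⟨nA, hnA⟩ : ∃ nA : A.X ⟶ A.X, nA = (𝟙 A.X) ^ m := ⟨_, rfl⟩
  obtain ⟨nB, hnB⟩ : ∃ nB : B.X ⟶ B.X, nB = (𝟙 B.X) ^ m := ⟨_, rfl⟩
  rw [← hnA]
  have hcomm : nA ≫ f = f ≫ nB := by rw [hnA, hnB]; exact A.pow_id_comp_eq_comp_pow_id f m
  have hηB : B.unitSection ≫ nB.left = B.unitSection := by
    change (η[B.X] : 𝟙_ (Over S) ⟶ B.X).left ≫ nB.left = (η[B.X] : 𝟙_ (Over S) ⟶ B.X).left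
    rw [← Over.comp_left, hnB, B.unit_comp_pow_id m]
  have hηf : A.unitSection ≫ f.left = B.unitSection := by
    change (η[A.X] : 𝟙_ (Over S) ⟶ A.X).left ≫ f.left = (η[B.X] : 𝟙_ (Over S) ⟶ B.X).left
    rw [← Over.comp_left, IsMonHom.one_hom]
  -- the torsion schemes `A[m] = S ×_{ε,A,[m]} A`, `B[m]` are finite étale over `S`
  haveI hfinA : IsFinite (pullback.fst A.unitSection nA.left) := by rw [hnA]; exact A.isFinite_fst_unit_pow_id hm
  haveI hetA : Etale (pullback.fst A.unitSection nA.left) := by rw [hnA]; exact A.etale_fst_unit_pow_id hm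
  haveI hfinB : IsFinite (pullback.fst B.unitSection nB.left) := by rw [hnB]; exact B.isFinite_fst_unit_pow_id hm
  haveI hetB : Etale (pullback.fst B.unitSection nB.left) := by rw [hnB]; exact B.etale_fst_unit_pow_id hm
  -- the two `S`-maps `σ = (π, ι ≫ f)`, `τ = (π, π ≫ ε)` from `A[m]` to `B[m]`
  have w₁ : pullback.fst A.unitSection nA.left ≫ B.unitSection =
      (pullback.snd A.unitSection nA.left ≫ f.left) ≫ nB.left := by
    rw [Category.assoc, ← Over.comp_left, ← hcomm, Over.comp_left, ← Category.assoc, ← pullback.condition,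
      Category.assoc, hηf]
  have w₂ : pullback.fst A.unitSection nA.left ≫ B.unitSection =
      (pullback.fst A.unitSection nA.left ≫ B.unitSection) ≫ nB.left := by
    rw [Category.assoc, hηB]
  obtain ⟨σ, hσ⟩ : ∃ σ : pullback A.unitSection nA.left ⟶ pullback B.unitSection nB.left,
      σ = pullback.lift (pullback.fst A.unitSection nA.left) (pullback.snd A.unitSection nA.left ≫ f.left) w₁ :=
    ⟨_, rfl⟩
  obtain ⟨τ, hτ⟩ : ∃ τ : pullback A.unitSection nA.left ⟶ pullback B.unitSection nB.left,
      τ = pullback.lift (pullback.fst A.unitSection nA.left) (pullback.fst A.unitSection nA.left ≫ B.unitSection) w₂ :=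
    ⟨_, rfl⟩
  have hσ₁ : σ ≫ pullback.fst B.unitSection nB.left = pullback.fst A.unitSection nA.left := by
    rw [hσ, pullback.lift_fst]
  have hσ₂ : σ ≫ pullback.snd B.unitSection nB.left = pullback.snd A.unitSection nA.left ≫ f.left := by
    rw [hσ, pullback.lift_snd]
  have hτ₁ : τ ≫ pullback.fst B.unitSection nB.left = pullback.fst A.unitSection nA.left := by
    rw [hτ, pullback.lift_fst]
  have hτ₂ : τ ≫ pullback.snd B.unitSection nB.left = pullback.fst A.unitSection nA.left ≫ B.unitSection := by
    rw [hτ, pullback.lift_snd]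
  have w : σ ≫ pullback.fst B.unitSection nB.left = τ ≫ pullback.fst B.unitSection nB.left := by rw [hσ₁, hτ₁]
  -- the equaliser `K = Eq(σ, τ) = A[m] ×_{(σ,τ), B[m] ×_S B[m], Δ} B[m]`, open and closed in `A[m]`
  obtain ⟨e, he⟩ : ∃ e : pullback (pullback.diagonal (pullback.fst B.unitSection nB.left)) (pullback.lift σ τ w) ⟶
      pullback A.unitSection nA.left, e = pullback.snd _ _ := ⟨_, rfl⟩
  haveI hopen : IsOpenImmersion e := by rw [he]; infer_instance
  haveI hclosed : IsClosedImmersion e := by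
    rw [he]; exact MorphismProperty.pullback_snd (P := @IsClosedImmersion) _ _ inferInstance
  have heq : e ≫ σ = e ≫ τ := by
    have hc := pullback.condition (f := pullback.diagonal (pullback.fst B.unitSection nB.left))
      (g := pullback.lift σ τ w)
    have h₁ := congrArg (· ≫ pullback.fst _ _) hc
    have h₂ := congrArg (· ≫ pullback.snd _ _) hc
    simp only [Category.assoc, pullback.diagonal_fst, pullback.diagonal_snd, Category.comp_id, pullback.lift_fst,
      pullback.lift_snd] at h₁ h₂
    rw [he, ← h₁, ← h₂]
  refine ⟨_, e ≫ pullback.fst A.unitSection nA.left, inferInstance, inferInstance, fun Ω _ s => ⟨?_⟩⟩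
  -- the points over `s : Spec Ω → S`
  have hιhom : pullback.snd A.unitSection nA.left ≫ A.X.hom = pullback.fst A.unitSection nA.left := by
    rw [← Over.w nA, ← Category.assoc, ← pullback.condition, Category.assoc, A.unitSection_comp_hom,
      Category.comp_id]
  refine Equiv.ofBijective
    (fun x => ⟨x.1 ≫ e ≫ pullback.snd A.unitSection nA.left, ?_, ?_, ?_⟩) ⟨?_, ?_⟩
  · -- over `s`
    rw [Category.assoc, Category.assoc, hιhom, ← Category.assoc]
    exact x.2
  · -- `z ≫ f = s ≫ ε_B`: `ι ≫ f = σ ≫ snd`, `e ≫ σ = e ≫ τ`, `τ ≫ snd = π ≫ ε_B`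
    rw [Category.assoc, Category.assoc, ← hσ₂, ← Category.assoc e σ, heq, Category.assoc, hτ₂, ← Category.assoc e,
      ← Category.assoc x.1]
    exact congrArg (· ≫ B.unitSection) x.2
  · -- `z ≫ [m] = s ≫ ε_A`: `ι ≫ [m] = π ≫ ε_A`
    rw [Category.assoc, Category.assoc, ← pullback.condition, ← Category.assoc e, ← Category.assoc x.1]
    exact congrArg (· ≫ A.unitSection) x.2
  · -- injective: `e` and `ι = pullback.snd ε [m]` (a base change of the section `ε`) are monomorphisms
    haveI : Mono A.unitSection := by
      haveI : IsSplitMono A.unitSection := IsSplitMono.mk' ⟨A.X.hom, A.unitSection_comp_hom⟩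
      infer_instance
    intro x x' h
    have h' := congrArg Subtype.val h
    dsimp only at h'
    rw [← Category.assoc, ← Category.assoc, cancel_mono, cancel_mono] at h'
    exact Subtype.ext h'
  · -- surjective: the point `(s, z)` of `A[m]` equalises `σ` and `τ`, hence factors through `K`
    intro z
    have hy : pullback.lift s z.1 z.2.2.2.symm ≫ σ = pullback.lift s z.1 z.2.2.2.symm ≫ τ := by
      apply pullback.hom_ext
      · rw [Category.assoc, Category.assoc, hσ₁, hτ₁]
      · rw [Category.assoc, Category.assoc, hσ₂, hτ₂, ← Category.assoc, ← Category.assoc, pullback.lift_snd,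
          pullback.lift_fst, z.2.2.1]
    have hw' : (pullback.lift s z.1 z.2.2.2.symm ≫ σ) ≫ pullback.diagonal (pullback.fst B.unitSection nB.left) =
        pullback.lift s z.1 z.2.2.2.symm ≫ pullback.lift σ τ w := by
      apply pullback.hom_ext
      · rw [Category.assoc, pullback.diagonal_fst, Category.comp_id, Category.assoc, pullback.lift_fst]
      · rw [Category.assoc, pullback.diagonal_snd, Category.comp_id, Category.assoc, pullback.lift_snd, hy]
    have hxe : pullback.lift _ _ hw' ≫ e = pullback.lift s z.1 z.2.2.2.symm := by rw [he, pullback.lift_snd]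
    refine ⟨⟨pullback.lift _ _ hw', ?_⟩, ?_⟩
    · rw [← Category.assoc, hxe, pullback.lift_fst]
    · apply Subtype.ext
      change pullback.lift _ _ hw' ≫ e ≫ pullback.snd A.unitSection nA.left = z.1
      rw [← Category.assoc, hxe, pullback.lift_snd]

omit [IsMonHom f] in
/-- **The `FibrePoints` reading of the point set**: morphisms `z : Spec Ω → A` over `s` with `z ≫ f = s ≫ ε_B` and
`z ≫ [m] = s ≫ ε_A` ARE the points `u ∈ A_s(Ω) = Hom_S(Spec Ω, A)` with `f(u) = 1` and `u^m = 1` (Mathlib's `Hom`-group: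
`1 = ! ≫ η`, `u^m = u ≫ [m]`). [cite: MumfordFogartyKirwan1994, Ch. 6 §1 (p. 115)] -/
theorem nonempty_kerTorsionLeft_equiv_fibrePoints (m : ℕ) {Ω : Type u} [Field Ω] (s : Spec (.of Ω) ⟶ S) :
    Nonempty ({z : Spec (.of Ω) ⟶ A.X.left // z ≫ A.X.hom = s ∧ z ≫ f.left = s ≫ B.unitSection ∧
        z ≫ (((𝟙 A.X : A.X ⟶ A.X) ^ m : A.X ⟶ A.X)).left = s ≫ A.unitSection} ≃
      {u : A.FibrePoints s // u ≫ f = 1 ∧ u ^ m = 1}) := by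
  have hpow : ∀ (u : A.FibrePoints s), u ^ m = u ≫ ((𝟙 A.X : A.X ⟶ A.X) ^ m) := fun u => by
    rw [MonObj.comp_pow, Category.comp_id]
  refine ⟨{ toFun := fun z => ⟨Over.homMk z.1 z.2.1, ?_, ?_⟩
            invFun := fun u => ⟨u.1.left, Over.w u.1, ?_, ?_⟩
            left_inv := fun z => rfl
            right_inv := fun u => rfl }⟩
  · apply Over.OverMorphism.ext
    change z.1 ≫ f.left = (1 : B.FibrePoints s).left
    rw [B.one_fibrePoints_left s]
    exact z.2.2.1
  · rw [hpow]
    apply Over.OverMorphism.ext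
    change z.1 ≫ (((𝟙 A.X : A.X ⟶ A.X) ^ m : A.X ⟶ A.X)).left = (1 : A.FibrePoints s).left
    rw [A.one_fibrePoints_left s]
    exact z.2.2.2
  · have h1 := congrArg Over.Hom.left u.2.1
    rw [Over.comp_left, B.one_fibrePoints_left s] at h1
    exact h1
  · have h2 := congrArg Over.Hom.left u.2.2
    rw [hpow, Over.comp_left, A.one_fibrePoints_left s] at h2
    exact h2

/-- **The `m`-torsion of `ker f` is a finite étale `S`-scheme with the expected geometric points.**  For an
`S`-homomorphism `f : A → B` of abelian schemes and `m` invertible in the residue fields of `S`, there is a finite étale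
`κ : K → S` whose `Ω`-points over every field-valued point `s : Spec Ω → S` correspond bijectively to
`{u ∈ A_s(Ω) | f(u) = 1, u^m = 1}` (`A_s(Ω) = A.FibrePoints s = Hom_S(Spec Ω, A)` with Mathlib's `Hom`-group).
[cite: MumfordFogartyKirwan1994, App. 7A (pp. 234–235)] [cite: GortzWedhorn2020, Def./Prop. 9.7]
[cite: BLRNeronModels1990, §7.3 Lemma 2 (b) (p. 180)] -/
theorem exists_finite_etale_specOver_equiv_ker_torsion {m : ℕ} (hm : ∀ s : S, (m : S.residueField s) ≠ 0) :
    ∃ (K : Scheme.{u}) (κ : K ⟶ S), IsFinite κ ∧ Etale κ ∧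
      ∀ (Ω : Type u) [Field Ω] (s : Spec (.of Ω) ⟶ S),
        Nonempty ({x : Spec (.of Ω) ⟶ K // x ≫ κ = s} ≃
          {u : A.FibrePoints s // u ≫ f = 1 ∧ u ^ m = 1}) := by
  obtain ⟨K, κ, hfin, het, hpts⟩ := A.exists_finite_etale_specOver_equiv_ker_torsion_left f hm
  refine ⟨K, κ, hfin, het, fun Ω _ s => ?_⟩
  obtain ⟨e₁⟩ := hpts Ω s
  obtain ⟨e₂⟩ := A.nonempty_kerTorsionLeft_equiv_fibrePoints f m s
  exact ⟨e₁.trans e₂⟩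

/-! ### §3 Local constancy of the count -/

/-- **`#{u ∈ A_s̄(Ω) | f(u) = 1, u^m = 1}` is finite** at every geometric point (`Ω` separably closed), for `m`
invertible on `S`: it is the number of geometric points of the finite étale `K_m(f) → S`
(★ `Morphisms.finite_specOver`). [cite: MumfordFogartyKirwan1994, App. 7A (pp. 234–235)]
[cite: GortzWedhorn2020, Prop. 12.21] -/
theorem finite_ker_torsion_fibrePoints {m : ℕ} (hm : ∀ s : S, (m : S.residueField s) ≠ 0) {Ω : Type u} [Field Ω]
    [IsSepClosed Ω] (s : Spec (.of Ω) ⟶ S) : Finite {u : A.FibrePoints s // u ≫ f = 1 ∧ u ^ m = 1} := by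
  obtain ⟨K, κ, hfin, het, hpts⟩ := A.exists_finite_etale_specOver_equiv_ker_torsion f hm
  obtain ⟨e⟩ := hpts Ω s
  haveI := hfin
  haveI := het
  haveI := finite_specOver κ s
  exact Finite.of_equiv _ e

/-- **Local constancy of the torsion counts of `ker f`**: over a (pre)connected base `S` and for `m` invertible in the
residue fields of `S`, the number of `Ω`-points `u` of the fibre `A_s̄` with `f(u) = 1` and `u^m = 1` is the SAME
at any two geometric points `s̄ : Spec Ω → S`, `t̄ : Spec Ω' → S` (`Ω`, `Ω'` separably closed) — the degree of the
finite étale `K_m(f) → S` is locally constant ([GortzWedhorn2020] (12.6.1); ★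
`Morphisms.natCard_specOver_eq_of_preconnectedSpace`).  This is the scheme-theoretic content of
[MumfordFogartyKirwan1994] App. 7A «`𝒜_{g,d,n} = ∐_δ 𝒜_{g,δ,n}` (open and closed)».
[cite: MumfordFogartyKirwan1994, App. 7A (pp. 234–235)] [cite: GortzWedhorn2020, (12.6.1)] -/
theorem natCard_ker_torsion_fibrePoints_eq_of_preconnectedSpace [PreconnectedSpace S] {m : ℕ}
    (hm : ∀ s : S, (m : S.residueField s) ≠ 0) {Ω Ω' : Type u} [Field Ω] [IsSepClosed Ω] [Field Ω'] [IsSepClosed Ω']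
    (s : Spec (.of Ω) ⟶ S) (t : Spec (.of Ω') ⟶ S) :
    Nat.card {u : A.FibrePoints s // u ≫ f = 1 ∧ u ^ m = 1} =
      Nat.card {v : A.FibrePoints t // v ≫ f = 1 ∧ v ^ m = 1} := by
  obtain ⟨K, κ, hfin, het, hpts⟩ := A.exists_finite_etale_specOver_equiv_ker_torsion f hm
  obtain ⟨es⟩ := hpts Ω s
  obtain ⟨et⟩ := hpts Ω' t
  haveI := hfin
  haveI := het
  rw [← Nat.card_congr es, ← Nat.card_congr et]
  exact natCard_specOver_eq_of_preconnectedSpace κ s t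

/-- The count as a DEGREE: `#{u ∈ A_s̄(Ω) | f(u) = 1, u^m = 1}` equals the degree `κ.finrank b` of the finite étale
`K_m(f) → S` at ANY point `b` of the preconnected base — the form in which the clopen-locus statement over a general
base is assembled. [cite: GortzWedhorn2020, (12.6.1)] [cite: MumfordFogartyKirwan1994, App. 7A (pp. 234–235)] -/
theorem exists_finrank_eq_natCard_ker_torsion_fibrePoints {m : ℕ} (hm : ∀ s : S, (m : S.residueField s) ≠ 0) :
    ∃ (K : Scheme.{u}) (κ : K ⟶ S) (_ : IsFinite κ) (_ : Etale κ),
      ∀ (Ω : Type u) [Field Ω] [IsSepClosed Ω] (s : Spec (.of Ω) ⟶ S),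
        Nat.card {u : A.FibrePoints s // u ≫ f = 1 ∧ u ^ m = 1} = κ.finrank (s.base (IsLocalRing.closedPoint Ω)) := by
  obtain ⟨K, κ, hfin, het, hpts⟩ := A.exists_finite_etale_specOver_equiv_ker_torsion f hm
  refine ⟨K, κ, hfin, het, fun Ω _ _ s => ?_⟩
  obtain ⟨e⟩ := hpts Ω s
  rw [← Nat.card_congr e]
  exact natCard_specOver_eq_finrank κ s

end AbelianSchemeOver

end Literature.AlgebraicGeometry.AbelianSchemes

end
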